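import Mathlib.MeasureTheory.Group.Prod
import Summits.Ventures.YMGap.YM3IR.AxialFamily
import HarnessLib

/-!
# YM₃ infrared statement — the fibre of the axial `b = 2` block constraint: pair parametrisation,
gauge equivariance, and the disintegration of Haar × Haar along the product map (track Y4, cell `pub-ymgap`;
ym3ir-theory-2, gen 6)

HONEST FRAMING.  WHAT THIS IS: a venture file of GROUP ALGEBRA and abstract HAAR-MEASURE identities, the
structural half of the first lemma of the infrared rung for theory-1's axial block family
(`YM3IR/AxialFamily.lean`, `axialBlk 2`): with block factor `b = 2` the coarse link variable is the ordered
product `v = u₁ u₂` of the two fine links of its axial line (`linePathProd_two`), so the block constraint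
couples ONLY these two links, and its fibre `{(u₁, u₂) : u₁ u₂ = v}` is the graph `u₂ = u₁⁻¹ v`,
parametrised by ONE free group element (`axialPairParam v u = (u, u⁻¹ v)`; `mem_range_axialPairParam_iff`).
We prove: the parametrisation is GAUGE-EQUIVARIANT (`axialPairParam_gauge`: endpoint gauges act on `v` as on
a coarse link, the middle-site gauge acts on the parameter by right translation); it is MEASURE-PRESERVING —
if the parameter `u` and the coarse variable `v` are independent with a left-invariant law `μ` each, the fine
pair `(u, u⁻¹ v)` has law `μ ⊗ μ` (`measurePreserving_axialPairParam`, Mathlib's shear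
`measurePreserving_prod_inv_mul`); hence the DISINTEGRATION `∫ f d(μ ⊗ μ) = ∫ dμ(v) ∫ dμ(u) f(u, u⁻¹ v)`
(`lintegral_prod_eq_lintegral_axialPairParam`), its conditional form
`E[f(u₁,u₂) φ(u₁u₂)] = ∫ φ(v) (∫ f(u, u⁻¹ v) dμ(u)) dμ(v)` (`lintegral_prod_mul_comp_mul`: GIVEN the coarse
variable, the fine pair is distributed as the image of `μ` under `axialPairParam v`), and, for a probability
`μ`, the law of the product is `μ` again (`map_mul_prod_eq_self`).  Read with `μ` = Haar on `SU(N)`: in the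
`b = 2` axially block-constrained Wilson system every constrained line is ONE SITE with state space `G` and a
priori measure Haar, every other link is a free site — so the conditional law given the coarse field is a
Gibbsian specification for a bounded finite-range potential with Haar a priori measure on `(pair-sites) ⊔
(free links)`, the setting of the tree's `gibbsSpecOfSummablePotential` / Dobrushin criteria; the companion
counts (8 plaquettes per pair-site, row sum `24 β_W`) are `YM3IR/AxialPairCount.lean`.  WHAT THIS IS NOT: no
specification is built here, no Dobrushin constant, no clustering statement, no new conjecture name; nothing
about the continuum limit, `d = 4`, or the Clay problem.  General `b` (parameters `u₁, …, u_{b-1}` free,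
`u_b = (u₁ ⋯ u_{b-1})⁻¹ v`) is the same induction and is not typed here.

WHY THIS IS NOVEL (one sentence): it certifies in the kernel that the axial block constraint of CMP 98 (15) at
`b = 2` has smooth one-parameter fibres carrying Haar measure equivariantly — the reason the constrained
system is an honest Gibbs specification site-by-site (no equivalence-of-ensembles step à la
Bertini–Cirillo–Olivieri is needed), which is what lets a printed high-temperature criterion act on it.

References: P. R. Halmos, Measure Theory, §59 (the shear transformations `S`, `S⁻¹`; Mathlib
`MeasureTheory.measurePreserving_prod_inv_mul`); T. Bałaban, CMP 98 (1985), (11), (15) p. 19 (axial averaging and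
its gauge covariance) [cite: Balaban1985Averaging, (15) p.19]; cell files ym3ir/YM3-IR-theory2.md §12, §12.F.
-/

noncomputable section

open MeasureTheory
open scoped ENNReal
open Literature.MathematicalPhysics.QuantumLattice Literature.MathematicalPhysics.QuantumFieldTheory

namespace Summit.Ventures.YMGap.YM3IR

variable {G : Type*} [Group G]

/-! ## The pair parametrisation of the constraint fibre -/

/-- The pair parametrisation of the fibre `{(u₁, u₂) : u₁ u₂ = v}` of the axial `b = 2` block constraint:
`u ↦ (u, u⁻¹ v)`. [cite: Balaban1985Averaging, (15) p.19] -/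
def axialPairParam (v u : G) : G × G := (u, u⁻¹ * v)

/-- First fine link = the parameter. [folklore] -/
@[simp] theorem axialPairParam_fst (v u : G) : (axialPairParam v u).1 = u := rfl

/-- Second fine link = `u⁻¹ v`. [folklore] -/
@[simp] theorem axialPairParam_snd (v u : G) : (axialPairParam v u).2 = u⁻¹ * v := rfl

/-- The parametrisation lands in the fibre: the ordered product of the pair is the coarse variable `v`. [folklore] -/
@[simp] theorem axialPairParam_fst_mul_snd (v u : G) :
    (axialPairParam v u).1 * (axialPairParam v u).2 = v :=
  mul_inv_cancel_left u v

/-- The parametrisation is injective. [folklore] -/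
theorem axialPairParam_injective (v : G) : Function.Injective (axialPairParam v) :=
  fun _ _ h => congrArg Prod.fst h

/-- The fibre of the product map over `v` is exactly the range of the parametrisation. [folklore] -/
theorem mem_range_axialPairParam_iff (v : G) (z : G × G) :
    z ∈ Set.range (axialPairParam v) ↔ z.1 * z.2 = v := by
  constructor
  · rintro ⟨u, rfl⟩
    exact axialPairParam_fst_mul_snd v u
  · intro h
    subst h
    exact ⟨z.1, Prod.ext rfl (inv_mul_cancel_left z.1 z.2)⟩

/-- GAUGE EQUIVARIANCE.  A lattice gauge transformation acts on the two fine links of the line by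
`u₁ ↦ g₀ u₁ h⁻¹`, `u₂ ↦ h u₂ g₁⁻¹` (`g₀, g₁` at the end points = the coarse sites, `h` at the middle fine site),
on the coarse link by `v ↦ g₀ v g₁⁻¹` (covariance of the axial average, CMP 98 (11)), and then on the parameter by
`u ↦ g₀ u h⁻¹`: the parametrisation intertwines the two actions. [cite: Balaban1985Averaging, (11) p.19] -/
theorem axialPairParam_gauge (g₀ h g₁ v u : G) :
    (g₀ * (axialPairParam v u).1 * h⁻¹, h * (axialPairParam v u).2 * g₁⁻¹) =
      axialPairParam (g₀ * v * g₁⁻¹) (g₀ * u * h⁻¹) := by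
  refine Prod.ext rfl ?_
  simp only [axialPairParam, mul_inv_rev, inv_inv]
  group

/-- Link to theory-1's axial block map at `b = 2`: the coarse link variable is the ordered product of the two
fine links of its line, `axialBlk 2 M U (y, i) = U(l₀) U(l₁)`. [cite: Balaban1985Averaging, (15) p.19] -/
theorem axialBlk_two {K : Type} [Group K] {M : ℕ} (U : GaugeConfig 3 (2 * M) K) (y : Site 3 M) (i : Fin 3) :
    axialBlk 2 M U (y, i) = U (lineSite 2 M y i 0, i) * U (lineSite 2 M y i 1, i) := by
  simp [axialBlk, linePathProd]

/-! ## Haar measure on the fibres -/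

variable [MeasurableSpace G] [MeasurableMul₂ G] [MeasurableInv G]

/-- The parametrisation at fixed coarse variable is measurable. [folklore] -/
theorem measurable_axialPairParam (v : G) : Measurable (axialPairParam v) :=
  measurable_id.prodMk (measurable_inv.mul_const v)

/-- The joint map `(u, v) ↦ (u, u⁻¹ v)` is measurable. [folklore] -/
theorem measurable_axialPairParam_uncurry :
    Measurable (fun z : G × G => axialPairParam z.2 z.1) :=
  measurable_fst.prodMk (measurable_fst.inv.mul measurable_snd)

/-- MEASURE PRESERVATION (Halmos's shear `S⁻¹`): if the parameter `u` and the coarse variable `v` are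
independent, each with the left-invariant law `μ`, then the fine pair `(u, u⁻¹ v)` has law `μ ⊗ μ`. [folklore] -/
theorem measurePreserving_axialPairParam (μ : Measure G) [SFinite μ] [μ.IsMulLeftInvariant] :
    MeasurePreserving (fun z : G × G => axialPairParam z.2 z.1) (μ.prod μ) (μ.prod μ) :=
  measurePreserving_prod_inv_mul μ μ

/-- DISINTEGRATION of `μ ⊗ μ` along the product map: `∫ f d(μ ⊗ μ) = ∫ dμ(v) ∫ dμ(u) f(u, u⁻¹ v)` — integrate
over the fibre of each coarse value with the parameter's Haar measure, then over the coarse value. [folklore] -/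
theorem lintegral_prod_eq_lintegral_axialPairParam (μ : Measure G) [SFinite μ] [μ.IsMulLeftInvariant]
    (f : G × G → ℝ≥0∞) (hf : Measurable f) :
    ∫⁻ z, f z ∂(μ.prod μ) = ∫⁻ v, ∫⁻ u, f (axialPairParam v u) ∂μ ∂μ := by
  have hg : Measurable fun z : G × G => f (axialPairParam z.2 z.1) :=
    hf.comp measurable_axialPairParam_uncurry
  rw [← (measurePreserving_axialPairParam μ).lintegral_comp hf,
    lintegral_prod_symm (fun z : G × G => f (axialPairParam z.2 z.1)) hg.aemeasurable]

/-- CONDITIONAL FORM: `E[f(u₁, u₂) φ(u₁ u₂)] = ∫ φ(v) (∫ f(u, u⁻¹ v) dμ(u)) dμ(v)` — given the coarse variable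
`v`, the fine pair is distributed as the image of `μ` under `axialPairParam v` (the fibre law is Haar in the
free parameter), for every weight `φ` of the coarse variable. [folklore] -/
theorem lintegral_prod_mul_comp_mul (μ : Measure G) [SFinite μ] [μ.IsMulLeftInvariant]
    (f : G × G → ℝ≥0∞) (φ : G → ℝ≥0∞) (hf : Measurable f) (hφ : Measurable φ) :
    ∫⁻ z, f z * φ (z.1 * z.2) ∂(μ.prod μ) = ∫⁻ v, φ v * ∫⁻ u, f (axialPairParam v u) ∂μ ∂μ := by
  have hg : Measurable fun z : G × G => f z * φ (z.1 * z.2) := hf.mul (hφ.comp measurable_mul)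
  rw [lintegral_prod_eq_lintegral_axialPairParam μ (fun z : G × G => f z * φ (z.1 * z.2)) hg]
  refine lintegral_congr fun v => ?_
  simp only [axialPairParam_fst_mul_snd]
  have hfv : Measurable fun u : G => f (axialPairParam v u) := hf.comp (measurable_axialPairParam v)
  rw [lintegral_mul_const (φ v) hfv, mul_comm]

/-- The law of the coarse variable: for a left-invariant PROBABILITY `μ`, the ordered product of two
independent `μ`-distributed links is `μ`-distributed (`μ ∗ μ = μ`). [folklore] -/
theorem map_mul_prod_eq_self (μ : Measure G) [IsProbabilityMeasure μ] [μ.IsMulLeftInvariant] :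
    (μ.prod μ).map (fun z : G × G => z.1 * z.2) = μ := by
  have hΦ := measurePreserving_axialPairParam μ
  have hcomp : (fun z : G × G => z.1 * z.2) ∘ (fun z : G × G => axialPairParam z.2 z.1) = Prod.snd := by
    funext z
    simp [axialPairParam]
  calc (μ.prod μ).map (fun z : G × G => z.1 * z.2)
      = ((μ.prod μ).map (fun z : G × G => axialPairParam z.2 z.1)).map (fun z : G × G => z.1 * z.2) := by
        rw [hΦ.map_eq]
    _ = (μ.prod μ).map Prod.snd := by
        rw [Measure.map_map measurable_mul measurable_axialPairParam_uncurry, hcomp]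
    _ = μ := by
        rw [Measure.map_snd_prod, measure_univ, one_smul]

end Summit.Ventures.YMGap.YM3IR

end
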